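import Summits.ResolutionOfSingularities.ResolutionOfSingularities.Theorems.FrobeniusLadderFInjectiveMacaulayficationBPBinomialTransversal
import HarnessLib

/-!
# The SPECIAL FACE of B9: on a T1 orbit whose orbit-free monomials are exactly `Y^{a₀}, Y^{a₁}, Y^{a₂}`, all `2×2` minors can vanish only if `31 = 0` in `k`
# (BED Ω₁ GLOBAL PATCH, F6 v2 §3, the 32 special-face (cone, orbit) pairs of the cure fan Σ₂; sequel of ✓ `BPBinomialTransversal`;
# crux `FInjectiveMacaulayfication` stmt-ResolutionOfSingularities-15315, chain w45a; seat res-L1-w45a-stub-3 g15)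

[OURS · L1 W4.5a] Support file (`--supports stmt-ResolutionOfSingularities-15315 --as helper`); theorems only; elementary algebra over a field; no named fact; NOT a statement of any
manuscript; nothing of the crux is proved. AI-written (AI review is weaker than expert review).
* `exists_kappa_of_minors_eq_zero` — the proportionality behind ✓ `face_iff_of_minors_eq_zero`, exported: if all minors over two non-orbit letters vanish then for some `κ ≠ 0`,
  `Y^{a_j}(y)·n_j = κ·(P_j − Q_j)` for every `j` (log-derivatives along the orbit + unimodularity).
* ★ `b9_face_absurd_of_minors_eq_zero` — B9 (`n = (9,9,9,9,2)`, `P − Q = (1,−3,2,0,0)`): if moreover `Y^{a₀}, Y^{a₁}, Y^{a₂}` are orbit-free, then with the torus point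
  `x_j = ∏_{i∉S} y_i^{V i j}` one gets `x₁⁹ = −3x₀⁹`, `x₂⁹ = 2x₀⁹`, `x₀x₂² = x₁³`, whence `31·x₀²⁷ = 0`: impossible when `31 ≠ 0` in `k`.
* ★★ `b9_exists_minor_ne_zero_of_ne31` — ✓ `b9_exists_minor_ne_zero` WITHOUT the face hypothesis, for `2·3·31 ≠ 0` in `k`: at every T1 point of every orbit some minor over two non-orbit
  letters is nonzero (with `∂θ` nonzero at its first letter).
[cite: IshiiSingularities2018, Lemma 4.4.24 (method)]
-/

set_option linter.dupNamespace false

noncomputable section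

namespace Summit.ResolutionOfSingularities.ResolutionOfSingularities.Theorems.FInjectiveMacaulayfication.BPBinomialTransversal

open MvPolynomial
open Summit.ResolutionOfSingularities.ResolutionOfSingularities.Theorems.FInjectiveMacaulayfication NewtonChartLemma

variable {k : Type} [Field k] {m : ℕ}

section Face

variable (V : Matrix (Fin m) (Fin m) ℕ) (hV : IsUnit (V.map (Nat.cast : ℕ → ℤ)).det)
  (n : Fin m → ℕ) (d : Fin m → ℕ) (a : Fin m → (Fin m →₀ ℕ)) (ha : ∀ j i, a j i + d i = V i j * n j)
  (P Q : Fin m → ℕ) (mm r s : Fin m →₀ ℕ) (hr : ∀ i, r i + mm i = ∑ j, V i j * P j) (hs : ∀ i, s i + mm i = ∑ j, V i j * Q j)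
  (S : Finset (Fin m)) (y : Fin m → k) (hy : ∀ i, y i = 0 ↔ i ∈ S)
  (hrS : ∀ i ∈ S, r i = 0) (hsS : ∀ i ∈ S, s i = 0)
  (hθy : MvPolynomial.eval y (∑ j : Fin m, monomial (a j) (1 : k)) = 0)
  (hwy : MvPolynomial.eval y (monomial r (1 : k) - monomial s 1) = 0)

include hV ha hr hs hy hrS hsS hθy hwy in
/-- **The proportionality constant.** If all `2×2` minors over non-orbit letters vanish (with an Ishii letter and some `r_i ≠ s_i` off `S`), then for some `κ ≠ 0`:
`Y^{a_j}(y)·n_j = κ·(P_j − Q_j)` for every `j`. (The computation inside ✓ `face_iff_of_minors_eq_zero`, exported.) [cite: IshiiSingularities2018, Lemma 4.4.24 (method)] -/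
theorem exists_kappa_of_minors_eq_zero
    (hmin : ∀ i i', i ∉ S → i' ∉ S →
      MvPolynomial.eval y (pderiv i (∑ j : Fin m, monomial (a j) (1 : k))) * MvPolynomial.eval y (pderiv i' (monomial r (1 : k) - monomial s 1)) -
        MvPolynomial.eval y (pderiv i' (∑ j : Fin m, monomial (a j) (1 : k))) * MvPolynomial.eval y (pderiv i (monomial r (1 : k) - monomial s 1)) = 0)
    (hnp : ∃ i, i ∉ S ∧ (r i : k) ≠ (s i : k)) (hl : ∃ l, l ∉ S ∧ MvPolynomial.eval y (pderiv l (∑ j : Fin m, monomial (a j) (1 : k))) ≠ 0) :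
    ∃ κ : k, κ ≠ 0 ∧ ∀ j, MvPolynomial.eval y (monomial (a j) (1 : k)) * (n j : k) = κ * ((P j : k) - (Q j : k)) := by
  classical
  obtain ⟨l, hlS, hθl⟩ := hl
  set θ : MvPolynomial (Fin m) k := ∑ j : Fin m, monomial (a j) (1 : k) with hθ
  set μ : Fin m → k := fun j => MvPolynomial.eval y (monomial (a j) (1 : k)) with hμ
  obtain ⟨hsr, hν⟩ := eval_r_eq_eval_s_and_ne_zero r s S y hy hrS hwy
  set ν : k := MvPolynomial.eval y (monomial r (1 : k)) with hνdef
  have hwl : MvPolynomial.eval y (pderiv l (monomial r (1 : k) - monomial s 1)) ≠ 0 :=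
    eval_pderiv_w_ne_zero_of_minors_eq_zero r s S y hy hrS hwy θ hmin hnp l hlS hθl
  set lam : k := MvPolynomial.eval y (pderiv l (monomial r (1 : k) - monomial s 1)) / MvPolynomial.eval y (pderiv l θ) with hlam
  have hlam0 : lam ≠ 0 := div_ne_zero hwl hθl
  set κ : k := ν / lam with hκ
  have hκ0 : κ ≠ 0 := div_ne_zero hν hlam0
  have key : ∀ i : Fin m, ∑ j : Fin m, ((a j i : ℕ) : k) * μ j = κ * ((r i : k) - (s i : k)) := by
    intro i
    by_cases hi : i ∈ S
    · rw [sum_exponent_mul_eval_eq_zero_of_mem S y hy a i hi, hrS i hi, hsS i hi, sub_self, mul_zero]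
    · have hprop : MvPolynomial.eval y (pderiv i (monomial r (1 : k) - monomial s 1)) = lam * MvPolynomial.eval y (pderiv i θ) := by
        have h := hmin l i hlS hi
        rw [hlam, div_mul_eq_mul_div, eq_div_iff hθl]
        linear_combination h
      have h1 := mul_eval_pderiv_sum y i a
      have h2 := mul_eval_pderiv_binomial y i r s
      rw [hsr, hprop] at h2
      have h3 : ((r i : k) - (s i : k)) * ν = lam * (∑ j : Fin m, ((a j i : ℕ) : k) * μ j) := by
        rw [← h1]; linear_combination (-1 : k) * h2
      rw [hκ, div_mul_eq_mul_div, eq_div_iff hlam0]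
      linear_combination (-1 : k) * h3
  have hθsum : ∑ j : Fin m, μ j = 0 := by
    have := hθy
    rw [map_sum] at this
    exact this
  have hVu : (V.map (Nat.cast : ℕ → k)).mulVec (fun j => μ j * (n j : k) - κ * ((P j : k) - (Q j : k))) = 0 := by
    ext i
    rw [Matrix.mulVec, dotProduct, Pi.zero_apply]
    simp only [Matrix.map_apply]
    have hsplit : ∑ j : Fin m, (V i j : k) * (μ j * (n j : k) - κ * ((P j : k) - (Q j : k))) =
        (∑ j : Fin m, ((a j i : ℕ) : k) * μ j) + (d i : k) * (∑ j : Fin m, μ j) -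
          κ * ((∑ j : Fin m, (V i j : k) * (P j : k)) - (∑ j : Fin m, (V i j : k) * (Q j : k))) := by
      rw [mul_sub, Finset.mul_sum, Finset.mul_sum, Finset.mul_sum, ← Finset.sum_sub_distrib, ← Finset.sum_add_distrib, ← Finset.sum_sub_distrib]
      refine Finset.sum_congr rfl fun j _ => ?_
      have haj : ((a j i : ℕ) : k) + (d i : k) = (V i j : k) * (n j : k) := by
        have := congrArg (Nat.cast : ℕ → k) (ha j i); push_cast at this; exact this
      linear_combination (-(μ j)) * haj
    have hrP : (∑ j : Fin m, (V i j : k) * (P j : k)) = (r i : k) + (mm i : k) := by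
      have := congrArg (Nat.cast : ℕ → k) (hr i); push_cast at this; exact this.symm
    have hsQ : (∑ j : Fin m, (V i j : k) * (Q j : k)) = (s i : k) + (mm i : k) := by
      have := congrArg (Nat.cast : ℕ → k) (hs i); push_cast at this; exact this.symm
    rw [hsplit, hθsum, mul_zero, add_zero, hrP, hsQ, key i]
    ring
  have hu := Matrix.eq_zero_of_mulVec_eq_zero (det_cast_ne_zero (k := k) V hV) hVu
  refine ⟨κ, hκ0, fun j => ?_⟩
  have hj := congr_fun hu j
  rw [Pi.zero_apply, sub_eq_zero] at hj
  exact hj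

/-- On the orbit, an `S`-free monomial `Y^{a_j}` times `∏_{i∉S} y_i^{d_i}` is the `n_j`-th power of the torus coordinate `x_j = ∏_{i∉S} y_i^{V i j}`. [certificate] -/
theorem eval_mul_prod_eq_pow (j : Fin m) (haj : ∀ i, a j i + d i = V i j * n j) (hfree : ∀ i ∈ S, a j i = 0) :
    MvPolynomial.eval y (monomial (a j) (1 : k)) * (∏ i ∈ Sᶜ, y i ^ d i) = (∏ i ∈ Sᶜ, y i ^ V i j) ^ n j := by
  rw [eval_monomial_eq_of_forall S y (a j) 1 hfree, one_mul, ← Finset.prod_mul_distrib, ← Finset.prod_pow]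
  refine Finset.prod_congr rfl fun i _ => ?_
  rw [← pow_add, ← pow_mul, haj i]

include hrS in
/-- On the orbit, `Y^r(y)·∏_{i∉S} y_i^{mm_i} = ∏_j x_j^{P_j}` (`x_j = ∏_{i∉S} y_i^{V i j}`). [certificate] -/
theorem eval_r_mul_prod_eq (hr : ∀ i, r i + mm i = ∑ j, V i j * P j) :
    MvPolynomial.eval y (monomial r (1 : k)) * (∏ i ∈ Sᶜ, y i ^ mm i) = ∏ j : Fin m, (∏ i ∈ Sᶜ, y i ^ V i j) ^ P j := by
  rw [eval_monomial_eq_of_forall S y r 1 hrS, one_mul, ← Finset.prod_mul_distrib]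
  simp_rw [← Finset.prod_pow, ← pow_mul]
  rw [Finset.prod_comm]
  refine Finset.prod_congr rfl fun i _ => ?_
  rw [← pow_add, hr i, Finset.prod_pow_eq_pow_sum]

end Face

/-! ## ★ The B9 special face -/

/-- ★ **THE B9 SPECIAL FACE IS INCONSISTENT UNLESS `31 = 0`.** With `n = (9,9,9,9,2)`, `P = (1,0,2,0,0)`, `Q = (0,3,0,0,0)`: if all minors vanish, `Y^{a₀}, Y^{a₁}, Y^{a₂}` are `S`-free, there is
an Ishii letter and some `r_i ≠ s_i` off `S`, and `3·31 ≠ 0` in `k`, contradiction (`x₁⁹ = −3x₀⁹`, `x₂⁹ = 2x₀⁹`, `x₀x₂² = x₁³` force `31x₀²⁷ = 0`). [OURS · F6 v2 §3] -/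
theorem b9_face_absurd_of_minors_eq_zero (h3 : (3 : k) ≠ 0) (h31 : (31 : k) ≠ 0) (V : Matrix (Fin 5) (Fin 5) ℕ) (hV : IsUnit (V.map (Nat.cast : ℕ → ℤ)).det)
    (d : Fin 5 → ℕ) (a : Fin 5 → (Fin 5 →₀ ℕ)) (ha : ∀ j i, a j i + d i = V i j * (![9, 9, 9, 9, 2] : Fin 5 → ℕ) j)
    (mm r s : Fin 5 →₀ ℕ) (hr : ∀ i, r i + mm i = ∑ j, V i j * (![1, 0, 2, 0, 0] : Fin 5 → ℕ) j) (hs : ∀ i, s i + mm i = ∑ j, V i j * (![0, 3, 0, 0, 0] : Fin 5 → ℕ) j)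
    (S : Finset (Fin 5)) (y : Fin 5 → k) (hy : ∀ i, y i = 0 ↔ i ∈ S) (hrS : ∀ i ∈ S, r i = 0) (hsS : ∀ i ∈ S, s i = 0)
    (hθy : MvPolynomial.eval y (∑ j : Fin 5, monomial (a j) (1 : k)) = 0) (hwy : MvPolynomial.eval y (monomial r (1 : k) - monomial s 1) = 0)
    (hnp : ∃ i, i ∉ S ∧ (r i : k) ≠ (s i : k)) (hl : ∃ l, l ∉ S ∧ MvPolynomial.eval y (pderiv l (∑ j : Fin 5, monomial (a j) (1 : k))) ≠ 0)
    (hmin : ∀ i i', i ∉ S → i' ∉ S →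
      MvPolynomial.eval y (pderiv i (∑ j : Fin 5, monomial (a j) (1 : k))) * MvPolynomial.eval y (pderiv i' (monomial r (1 : k) - monomial s 1)) -
        MvPolynomial.eval y (pderiv i' (∑ j : Fin 5, monomial (a j) (1 : k))) * MvPolynomial.eval y (pderiv i (monomial r (1 : k) - monomial s 1)) = 0)
    (hf0 : ∀ i ∈ S, a 0 i = 0) (hf1 : ∀ i ∈ S, a 1 i = 0) (hf2 : ∀ i ∈ S, a 2 i = 0) : False := by
  obtain ⟨κ, -, hκ⟩ := exists_kappa_of_minors_eq_zero V hV ![9, 9, 9, 9, 2] d a ha ![1, 0, 2, 0, 0] ![0, 3, 0, 0, 0] mm r s hr hs S y hy hrS hsS hθy hwy hmin hnp hl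
  -- the torus point and the common factors
  set x : Fin 5 → k := fun j => ∏ i ∈ Sᶜ, y i ^ V i j with hx
  set D : k := ∏ i ∈ Sᶜ, y i ^ d i with hD
  set M' : k := ∏ i ∈ Sᶜ, y i ^ mm i with hM'
  have hyT : ∀ i ∈ Sᶜ, y i ≠ 0 := fun i hi h0 => (Finset.mem_compl.mp hi) ((hy i).mp h0)
  have hx0 : x 0 ≠ 0 := Finset.prod_ne_zero_iff.mpr fun i hi => pow_ne_zero _ (hyT i hi)
  have hM'0 : M' ≠ 0 := Finset.prod_ne_zero_iff.mpr fun i hi => pow_ne_zero _ (hyT i hi)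
  -- `μ_j D = x_j^9` for `j = 0, 1, 2`
  have e0 := eval_mul_prod_eq_pow V ![9, 9, 9, 9, 2] d a S y 0 (ha 0) hf0
  have e1 := eval_mul_prod_eq_pow V ![9, 9, 9, 9, 2] d a S y 1 (ha 1) hf1
  have e2 := eval_mul_prod_eq_pow V ![9, 9, 9, 9, 2] d a S y 2 (ha 2) hf2
  simp only [Matrix.cons_val_zero, Matrix.cons_val_one, Matrix.cons_val] at e0 e1 e2
  -- the κ relations for `j = 0, 1, 2`
  have k0 := hκ 0
  have k1 := hκ 1
  have k2 := hκ 2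
  simp only [Matrix.cons_val_zero, Matrix.cons_val_one, Matrix.cons_val, Nat.cast_ofNat, Nat.cast_zero, Nat.cast_one, sub_zero, zero_sub, mul_one] at k0 k1 k2
  -- `x₁⁹ = −3 x₀⁹`, `x₂⁹ = 2 x₀⁹`
  have h9 : (9 : k) ≠ 0 := by
    have : (9 : k) = 3 * 3 := by norm_num
    rw [this]; exact mul_ne_zero h3 h3
  have r1 : x 1 ^ 9 = -3 * x 0 ^ 9 := by
    rw [← e1, ← e0]
    have : MvPolynomial.eval y (monomial (a 1) (1 : k)) = -3 * MvPolynomial.eval y (monomial (a 0) (1 : k)) := by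
      apply mul_right_cancel₀ h9
      linear_combination k1 + 3 * k0
    rw [this]; ring
  have r2 : x 2 ^ 9 = 2 * x 0 ^ 9 := by
    rw [← e2, ← e0]
    have : MvPolynomial.eval y (monomial (a 2) (1 : k)) = 2 * MvPolynomial.eval y (monomial (a 0) (1 : k)) := by
      apply mul_right_cancel₀ h9
      linear_combination k2 - 2 * k0
    rw [this]; ring
  -- `x₀ x₂² = x₁³` from `w(y) = 0`
  have wr := eval_r_mul_prod_eq V ![1, 0, 2, 0, 0] mm r S y hrS hr
  have ws := eval_r_mul_prod_eq V ![0, 3, 0, 0, 0] mm s S y hsS hs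
  rw [Fin.prod_univ_five] at wr ws
  simp only [Matrix.cons_val_zero, Matrix.cons_val_one, Matrix.cons_val, pow_zero, pow_one, mul_one, one_mul] at wr ws
  have hsr : MvPolynomial.eval y (monomial s (1 : k)) = MvPolynomial.eval y (monomial r (1 : k)) :=
    (eval_r_eq_eval_s_and_ne_zero r s S y hy hrS hwy).1
  have r3 : x 0 * x 2 ^ 2 = x 1 ^ 3 := by
    have h := wr
    rw [← hsr, ws] at h
    exact h.symm
  -- `31 x₀²⁷ = 0`
  have r1' : x 0 ^ 3 * x 2 ^ 6 = -3 * x 0 ^ 9 := by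
    rw [← r1]
    linear_combination (x 0 ^ 2 * x 2 ^ 4 + x 0 * x 2 ^ 2 * x 1 ^ 3 + x 1 ^ 6) * r3
  have fin : (31 : k) * x 0 ^ 27 = 0 := by
    linear_combination ((x 0 ^ 3 * x 2 ^ 6) ^ 2 + (x 0 ^ 3 * x 2 ^ 6) * (-3 * x 0 ^ 9) + (-3 * x 0 ^ 9) ^ 2) * r1' -
      x 0 ^ 9 * (x 2 ^ 9 + 2 * x 0 ^ 9) * r2
  exact (mul_ne_zero h31 (pow_ne_zero 27 hx0)) fin

/-- ★★ **B9 / `X₀X₂² − X₁³`, `2·3·31 ≠ 0` in `k`: a nonzero minor at EVERY T1 point of EVERY orbit** (the face hypothesis of ✓ `b9_exists_minor_ne_zero` removed). [OURS · F6 v2 §3] -/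
theorem b9_exists_minor_ne_zero_of_ne31 (h2 : (2 : k) ≠ 0) (h3 : (3 : k) ≠ 0) (h31 : (31 : k) ≠ 0) (V : Matrix (Fin 5) (Fin 5) ℕ) (hV : IsUnit (V.map (Nat.cast : ℕ → ℤ)).det)
    (d : Fin 5 → ℕ) (a : Fin 5 → (Fin 5 →₀ ℕ)) (ha : ∀ j i, a j i + d i = V i j * (![9, 9, 9, 9, 2] : Fin 5 → ℕ) j)
    (mm r s : Fin 5 →₀ ℕ) (hr : ∀ i, r i + mm i = ∑ j, V i j * (![1, 0, 2, 0, 0] : Fin 5 → ℕ) j) (hs : ∀ i, s i + mm i = ∑ j, V i j * (![0, 3, 0, 0, 0] : Fin 5 → ℕ) j)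
    (S : Finset (Fin 5)) (y : Fin 5 → k) (hy : ∀ i, y i = 0 ↔ i ∈ S) (hrS : ∀ i ∈ S, r i = 0) (hsS : ∀ i ∈ S, s i = 0)
    (hθy : MvPolynomial.eval y (∑ j : Fin 5, monomial (a j) (1 : k)) = 0) (hwy : MvPolynomial.eval y (monomial r (1 : k) - monomial s 1) = 0)
    (hnp : ∃ i, i ∉ S ∧ (r i : k) ≠ (s i : k)) (hl : ∃ l, l ∉ S ∧ MvPolynomial.eval y (pderiv l (∑ j : Fin 5, monomial (a j) (1 : k))) ≠ 0) :
    ∃ i i', i ∉ S ∧ i' ∉ S ∧ i ≠ i' ∧ MvPolynomial.eval y (pderiv i (∑ j : Fin 5, monomial (a j) (1 : k))) ≠ 0 ∧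
      MvPolynomial.eval y (pderiv i (∑ j : Fin 5, monomial (a j) (1 : k))) * MvPolynomial.eval y (pderiv i' (monomial r (1 : k) - monomial s 1)) -
        MvPolynomial.eval y (pderiv i' (∑ j : Fin 5, monomial (a j) (1 : k))) * MvPolynomial.eval y (pderiv i (monomial r (1 : k) - monomial s 1)) ≠ 0 := by
  by_cases hface : (∀ i ∈ S, a 0 i = 0) ∧ (∀ i ∈ S, a 1 i = 0) ∧ (∀ i ∈ S, a 2 i = 0) ∧ ¬ (∀ i ∈ S, a 3 i = 0) ∧ ¬ (∀ i ∈ S, a 4 i = 0)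
  · -- the special face: all minors zero would force `31 = 0`
    by_contra hcon
    push Not at hcon
    refine b9_face_absurd_of_minors_eq_zero h3 h31 V hV d a ha mm r s hr hs S y hy hrS hsS hθy hwy hnp hl (fun i i' hi hi' => ?_) hface.1 hface.2.1 hface.2.2.1
    by_cases hθi : MvPolynomial.eval y (pderiv i (∑ j : Fin 5, monomial (a j) (1 : k))) = 0
    · by_cases hθi' : MvPolynomial.eval y (pderiv i' (∑ j : Fin 5, monomial (a j) (1 : k))) = 0
      · rw [hθi, hθi', zero_mul, zero_mul, sub_zero]
      · rcases eq_or_ne i' i with h | h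
        · subst h; ring
        · have := hcon i' i hi' hi h hθi'
          linear_combination (-1 : k) * this
    · rcases eq_or_ne i i' with h | h
      · subst h; ring
      · exact hcon i i' hi hi' h hθi
  · exact b9_exists_minor_ne_zero h2 h3 V hV d a ha mm r s hr hs S y hy hrS hsS hθy hwy hnp hl hface

end Summit.ResolutionOfSingularities.ResolutionOfSingularities.Theorems.FInjectiveMacaulayfication.BPBinomialTransversal

end
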